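import Literature.AlgebraicGeometry.Morphisms.CechModuleShortExact
import Literature.AlgebraicGeometry.Modules.TorsionLocalizing
import HarnessLib

/-!
# The quotient `M / M[𝓘]` by the torsion subsheaf: short exactness and annihilation

For a sheaf of `𝒪_X`-modules `M`, an ideal sheaf `I : X.IdealSheafData` and the torsion subsheaf
`M[𝓘] ⊆ M` (`Modules/Torsion`), the sequence `0 → M[𝓘] → M → M/M[𝓘] → 0` (cokernel in the abelian
category `X.Modules`) is short exact (`shortExact_torsion`), and — the point of the dévissage steps
(ii) of Görtz–Wedhorn I, Lemma 12.63 ("`𝓘𝓕` is annihilated by `𝓘ⁿ⁻¹` and `𝓕/𝓘𝓕` is annihilated by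
`𝓘`", here in the dual form with torsion instead of products) — **if `𝒥 M = 0` and `𝓘·𝓘' ≤ 𝒥` then
`(𝒥 + 𝓘') · (M/M[𝓘]) = 0`** (`isKilledBy_cokernel_torsionι`): over an affine `V` every section of
the quotient lifts to `M` (`M[𝓘]` is affine-localizing, `Modules/TorsionLocalizing`, so sections are
right exact, Hartshorne II Prop. 5.6), and `𝓘'(V) m ⊆ M[𝓘](V)` because `𝓘(V)𝓘'(V) ⊆ 𝒥(V)` kills `m`.

Everything is proved; no named facts. Mathlib searched (pin v4.32): `ShortComplex.exact_cokernel`,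
`ShortComplex.ShortExact.mk'`, `Submodule.mem_sup`, `Ideal.mul_mem_mul` (used).

## References

* U. Görtz, T. Wedhorn, *Algebraic Geometry I: Schemes*, 2nd ed. (2020): Lemma 12.63 (ii), p. 436–437
  (read via the held copy). [GortzWedhorn2020]
* R. Hartshorne, *Algebraic Geometry*, GTM 52 (1977): II Prop. 5.6 (p. 113). [Hartshorne1977]
-/

noncomputable section

open CategoryTheory AlgebraicGeometry Limits TopologicalSpace Opposite
open Literature.AlgebraicGeometry.Morphisms

universe u

namespace Literature.AlgebraicGeometry.Modules

variable {X : Scheme.{u}} (M : X.Modules) (I : X.IdealSheafData)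

/-- **`0 → M[𝓘] → M → M/M[𝓘] → 0` is short exact** in `X.Modules`. [folklore] -/
theorem shortExact_torsion :
    (ShortComplex.mk (torsionι M I) (cokernel.π (torsionι M I)) (cokernel.condition _)).ShortExact :=
  ShortComplex.ShortExact.mk' (ShortComplex.exact_cokernel _) inferInstance inferInstance

variable {M I}

/-- **Annihilation of the torsion quotient**: if `M` is affine-localizing, the affine components of `𝓘`
are finitely generated, `𝒥 M = 0` and `𝓘 𝓘' ≤ 𝒥`, then `(𝒥 + 𝓘') (M/M[𝓘]) = 0` (Görtz–Wedhorn I,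
Lemma 12.63 (ii), torsion form). [cite: GortzWedhorn2020, Lemma 12.63 (ii) (p. 436)] -/
theorem isKilledBy_cokernel_torsionι (hM : IsAffineLocalizing M) (hI : ∀ V : X.affineOpens, (I.ideal V).FG)
    {J I' : X.IdealSheafData} (hJ : IsKilledBy J M) (hII' : I * I' ≤ J) :
    IsKilledBy (J ⊔ I') (cokernel (torsionι M I)) := by
  intro V r hr q
  have hS := shortExact_torsion M I
  obtain ⟨m, rfl⟩ := app_surjective_of_shortExact hS (isAffineLocalizing_torsion I hM hI) V.2 q
  rw [Scheme.IdealSheafData.ideal_sup] at hr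
  obtain ⟨j, hj, i', hi', rfl⟩ := Submodule.mem_sup.mp hr
  change (j + i') • (cokernel.π (torsionι M I)).app V m = 0
  rw [← Scheme.Modules.Hom.app_smul, add_smul, hJ V j hj m, zero_add]
  -- `i' • m` is an `𝓘`-torsion section over the affine `V`
  have htor : IsTorsionSection M I V (i' • m) := by
    rw [isTorsionSection_iff_of_isAffineOpen M I V.2]
    intro s hs
    rw [smul_smul]
    exact hJ V (s * i') (hII' V (by
      rw [Scheme.IdealSheafData.ideal_mul]
      exact Ideal.mul_mem_mul hs hi')) m
  obtain ⟨t, ht⟩ := exists_torsionι_app_eq M I (i' • m) htor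
  rw [← ht]
  exact app_app_eq_zero (ShortComplex.mk (torsionι M I) (cokernel.π (torsionι M I)) (cokernel.condition _)) V t

end Literature.AlgebraicGeometry.Modules

end
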